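import Literature.Analysis.FluidPDE.GKPRigidityBackwardUniqueness
import Literature.Analysis.FluidPDE.Vorticity
import HarnessLib

/-!
# Crux RecurrentLiouville (stmt-NavierStokesRegularity-1589), line Sketch — stub stub_satFarFieldVorticityVanishes: the far-field vorticity of a dark field vanishes

Theorems-only file (no definitions, no named facts).

`stub_satFarFieldVorticityVanishes` (D2) — THE FAR-FIELD VORTICITY OF A DARK FIELD VANISHES.
Let `(U, p)` solve Navier–Stokes (`ν = 1`, no force) in `𝒟'(Ω)`, `Ω = (-1, 0) × {‖x‖ > R}`
(`R ≥ 0`), with `C^∞` slices, jointly continuous spatial derivatives `(t, x) ↦ D_xⁿU(t, x)`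
(`n ≤ 4`) and `‖D_xⁿU‖ ≤ K` on `Ω` (`n ≤ 3`) — the smooth far-field representative package that
`satFR_representative` of the landed D1 file (`SqueezeCycleRecurrentLiouvilleFarFieldRegularity`)
delivers; let `U = u` a.e. on `Ω`, where the final-time trace of `u` vanishes off the ball in
`𝒟'`: `∫ ⟪u(t), φ⟫ → 0` as `t ↑ 0` for every test field `φ` with `tsupport φ ⊆ {‖x‖ > R}`.
Conclusion: `∇ ∧ U(t, ·) = 0` on `{‖x‖ > R + 2}` for every `t ∈ (-1, 0)`.  This is Step 3 of the
dark-profiles argument (Escauriaza–Seregin–Šverák 2003, §3 (3.31)–(3.32) with the half-space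
backward uniqueness Thm. 5.1; Lemarié-Rieusset 2016, proof of Thm. 15.4, Step 3): D1 supplies the
regular far-field representative, this file turns "trace zero off the ball" into "far field
irrotational", and D3 concludes by interior unique continuation and the harmonic Liouville theorem.

Route: a smooth cutoff `χ = 1 - b`, `b` a `ContDiffBump` at the origin (`χ = 0` on
`{‖x‖ ≤ R + 1/2}`, `χ = 1` on `{‖x‖ ≥ R + 1}`, `tsupport χ ⊆ {‖x‖ > R}`), turns the far-supported
weak vanishing of `u` into the weak vanishing of `χu` against EVERY test field
(`∫ ⟪χu(t), φ⟫ = ∫ ⟪u(t), χφ⟫`, `tsupport (χφ) ⊆ tsupport χ`), while `χu = u = U` a.e. on the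
smaller region `Ω₁ = (-1, 0) × {‖x‖ > R + 1}`, on which `(U, p)` is still a distributional solution
(`IsDistributionalNSSolutionOn.of_le`) with the same regularity and bounds; the proved far-field
backward-uniqueness step `farField_curl_eq_zero_of_frame` (`GKPRigidityBackwardUniqueness.lean`,
the tree's Carleman chain in the class `C¹ ∩ {∂ₓω ∈ C¹}`) with `ν = 1`, window `(-1, 0)` and
radius `R + 1` gives `∇ ∧ U = 0` beyond `R + 1 + √(1 · (0 - (-1))) = R + 2`.

The stub was re-registered (2026-08-16) in this smooth-representative form because the only
half-space backward-uniqueness statement of the tree matching the earlier jointly-`C¹`/`C²`-slice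
vorticity package is the unproved named fact `ess_backward_uniqueness_C1`, whereas
`farField_curl_eq_zero_of_frame` is proved.

## References

* L. Escauriaza, G. Seregin, V. Šverák, Russian Math. Surveys 58 (2003) 211–250, §3
  (3.31)–(3.32), Thm. 5.1. [EscauriazaSereginSverak2003]
* P. G. Lemarié-Rieusset, *The Navier–Stokes Problem in the 21st Century* (2016),
  doi:10.1201/b19556, proof of Thm. 15.4, Step 3 (PDF pp. 568–569). [LemarieRieusset2016]
-/

noncomputable section

-- the sub-problem namespace repeats the summit name (D-0017 layout `Summit.<S>.<P>.Theorems`)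
set_option linter.dupNamespace false

namespace Summit.NavierStokesRegularity.NavierStokesRegularity.Theorems

open MeasureTheory Set Function Filter Topology TopologicalSpace Metric
open Literature.Analysis.FluidPDE
open scoped NNReal ENNReal RealInnerProductSpace Laplacian ContDiff

/-- **D2, the far-field vorticity of a dark field vanishes** (Escauriaza–Seregin–Šverák 2003, §3
(3.31)–(3.32) with Thm. 5.1).  Let `(U, p)` solve Navier–Stokes (`ν = 1`, no force) in
`𝒟'(Ω)`, `Ω = (-1, 0) × {‖x‖ > R}` (`R ≥ 0`), with `C^∞` slices, jointly continuous `D_xⁿU`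
(`n ≤ 4`) and `‖D_xⁿU‖ ≤ K` (`n ≤ 3`) on `Ω`; let `U = u` a.e. on `Ω`, where the final-time trace
of `u` vanishes off the ball in `𝒟'`: `∫ ⟪u(t), φ⟫ → 0` as `t ↑ 0` for every test field `φ`
with `tsupport φ ⊆ {‖x‖ > R}`.  Then `∇ ∧ U(t, ·) = 0` on `{‖x‖ > R + 2}` for `t ∈ (-1, 0)`.
Proof: with a smooth cutoff `χ`, `χ = 0` on `{‖x‖ ≤ R + 1/2}`, `χ = 1` on `{‖x‖ ≥ R + 1}`, the
field `χu` agrees with `U` a.e. on `(-1, 0) × {‖x‖ > R + 1}` and `∫ ⟪χu(t), φ⟫ = ∫ ⟪u(t), χφ⟫ → 0`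
for EVERY test field `φ`; `farField_curl_eq_zero_of_frame` (radius `R + 1`, `ν = 1`,
window `(-1, 0)`) gives `∇ ∧ U = 0` on `{‖x‖ > R + 1 + 1}`.
[cite: EscauriazaSereginSverak2003, §3 (3.31)-(3.32) and Thm. 5.1] -/
theorem stub_satFarFieldVorticityVanishes :
    ∀ (u U : ℝ → EuclideanSpace ℝ (Fin 3) → EuclideanSpace ℝ (Fin 3))
      (p : ℝ → EuclideanSpace ℝ (Fin 3) → ℝ) (R K : ℝ), 0 ≤ R →
      uncurry U =ᵐ[volume.restrict
        (Ioo (-1 : ℝ) 0 ×ˢ (closedBall (0 : EuclideanSpace ℝ (Fin 3)) R)ᶜ)] uncurry u →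
      IsDistributionalNSSolutionOn
        ⟨Ioo (-1 : ℝ) 0 ×ˢ (closedBall (0 : EuclideanSpace ℝ (Fin 3)) R)ᶜ,
          isOpen_Ioo.prod isClosed_closedBall.isOpen_compl⟩ 1 0 U p →
      (∀ w ∈ Ioo (-1 : ℝ) 0 ×ˢ (closedBall (0 : EuclideanSpace ℝ (Fin 3)) R)ᶜ,
        ContDiffAt ℝ (⊤ : ℕ∞) (U w.1) w.2) →
      (∀ n ≤ 4, ContinuousOn
        (fun w : ℝ × EuclideanSpace ℝ (Fin 3) => iteratedFDeriv ℝ n (U w.1) w.2)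
        (Ioo (-1 : ℝ) 0 ×ˢ (closedBall (0 : EuclideanSpace ℝ (Fin 3)) R)ᶜ)) →
      (∀ n ≤ 3, ∀ w ∈ Ioo (-1 : ℝ) 0 ×ˢ (closedBall (0 : EuclideanSpace ℝ (Fin 3)) R)ᶜ,
        ‖iteratedFDeriv ℝ n (U w.1) w.2‖ ≤ K) →
      (∀ φ : EuclideanSpace ℝ (Fin 3) → EuclideanSpace ℝ (Fin 3),
        Literature.Analysis.FunctionSpaces.IsTestFunctionOn (⊤ : Opens (EuclideanSpace ℝ (Fin 3))) φ →
        tsupport φ ⊆ (closedBall (0 : EuclideanSpace ℝ (Fin 3)) R)ᶜ →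
        Tendsto (fun t => ∫ x, ⟪u t x, φ x⟫) (𝓝[<] (0 : ℝ)) (𝓝 0)) →
      ∀ t ∈ Ioo (-1 : ℝ) 0, ∀ x : EuclideanSpace ℝ (Fin 3), R + 2 < ‖x‖ → curl (U t) x = 0 := by
  intro u U p R K hR hae hsol hCD hjc hbdK hfinal
  -- the cutoff `χ = 1 - bump`
  set b : ContDiffBump (0 : EuclideanSpace ℝ (Fin 3)) := ⟨R + 1 / 2, R + 1, by linarith, by linarith⟩
    with hb
  set χ : EuclideanSpace ℝ (Fin 3) → ℝ := fun x => 1 - b x with hχ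
  have hχs : ContDiff ℝ (⊤ : ℕ∞) χ := contDiff_const.sub b.contDiff
  have hχ1 : ∀ x : EuclideanSpace ℝ (Fin 3), R + 1 < ‖x‖ → χ x = 1 := fun x hx => by
    have : b x = 0 := b.zero_of_le_dist (by rw [dist_zero_right]; exact hx.le)
    simp [hχ, this]
  have hχsupp : tsupport χ ⊆ (closedBall (0 : EuclideanSpace ℝ (Fin 3)) R)ᶜ := by
    have hcl : IsClosed {x : EuclideanSpace ℝ (Fin 3) | R + 1 / 2 ≤ ‖x‖} :=
      isClosed_le continuous_const continuous_norm
    refine (closure_minimal (fun x hx => ?_) hcl).trans fun x hx => ?_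
    · rw [mem_setOf_eq]
      by_contra h
      have : b x = 1 :=
        b.one_of_mem_closedBall (by rw [mem_closedBall, dist_zero_right]; exact (not_le.1 h).le)
      exact hx (by simp [hχ, this])
    · rw [mem_compl_iff, mem_closedBall, dist_zero_right, not_le]
      have := hx.out
      linarith
  -- the smaller region `Ω₁ = (-1, 0) × {‖x‖ > R + 1}`
  set S₁ : Set (EuclideanSpace ℝ (Fin 3)) := (closedBall (0 : EuclideanSpace ℝ (Fin 3)) (R + 1))ᶜ
    with hS₁
  have hsub : S₁ ⊆ (closedBall (0 : EuclideanSpace ℝ (Fin 3)) R)ᶜ :=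
    compl_subset_compl.2 (closedBall_subset_closedBall (by linarith))
  have hsubΩ : Ioo (-1 : ℝ) 0 ×ˢ S₁ ⊆ Ioo (-1 : ℝ) 0 ×ˢ (closedBall (0 : EuclideanSpace ℝ (Fin 3)) R)ᶜ :=
    prod_mono Subset.rfl hsub
  -- the cut field `χ u`
  have hae₁ : uncurry U =ᵐ[volume.restrict (Ioo (-1 : ℝ) 0 ×ˢ S₁)]
      uncurry fun t x => χ x • u t x := by
    filter_upwards [ae_restrict_of_ae_restrict_of_subset hsubΩ hae,
      ae_restrict_mem ((isOpen_Ioo.prod isClosed_closedBall.isOpen_compl).measurableSet)]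
      with z hz hzm
    have hz2 : R + 1 < ‖z.2‖ := by
      have h := hzm.2
      rwa [hS₁, mem_compl_iff, mem_closedBall, dist_zero_right, not_le] at h
    simp only [uncurry] at hz ⊢
    rw [hz, hχ1 z.2 hz2, one_smul]
  have hfinal₁ : ∀ φ : EuclideanSpace ℝ (Fin 3) → EuclideanSpace ℝ (Fin 3),
      Literature.Analysis.FunctionSpaces.IsTestFunctionOn (⊤ : Opens (EuclideanSpace ℝ (Fin 3))) φ →
      Tendsto (fun t => ∫ x, ⟪(fun t x => χ x • u t x) t x, φ x⟫) (𝓝[<] (0 : ℝ)) (𝓝 0) := by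
    intro φ hφ
    have hφ' : Literature.Analysis.FunctionSpaces.IsTestFunctionOn
        (⊤ : Opens (EuclideanSpace ℝ (Fin 3))) (fun x => χ x • φ x) :=
      ⟨hχs.smul hφ.contDiff, hφ.hasCompactSupport.smul_left (f := χ), by simp⟩
    have h := hfinal _ hφ' ((tsupport_smul_subset_left χ φ).trans hχsupp)
    refine h.congr fun t => ?_
    refine integral_congr_ae (Eventually.of_forall fun x => ?_)
    simp only [real_inner_smul_left, real_inner_smul_right]
  have hsol₁ : IsDistributionalNSSolutionOn
      ⟨Ioo (-1 : ℝ) 0 ×ˢ S₁, isOpen_Ioo.prod isClosed_closedBall.isOpen_compl⟩ 1 0 U p :=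
    hsol.of_le fun w hw => hsubΩ hw
  have h := farField_curl_eq_zero_of_frame one_pos (by norm_num : (-1 : ℝ) < 0)
    (by linarith : 0 ≤ R + 1) hfinal₁ hae₁ hsol₁ (fun w hw => hCD w (hsubΩ hw))
    (fun n hn => (hjc n hn).mono hsubΩ) (fun n hn w hw => hbdK n hn w (hsubΩ hw))
  intro t ht x hx
  refine h t ht x ?_
  have e : Real.sqrt (1 * (0 - -1)) = 1 := by norm_num
  rw [e]
  linarith

end Summit.NavierStokesRegularity.NavierStokesRegularity.Theorems

end
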